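import Summits.CriticalPhenomena.PercolationContinuityZ3.Theorems.PercNearOneGluingNoHeavyLowerTailTwoPartitionKleitman
import HarnessLib.Audit

/-!
# `NoHeavyLowerTail` (crux stmt-CriticalPhenomena-4575), master-family hierarchy P3 (gen 25): a THREE-SET antipodal functional —
# the two-copy comb form of the candidate inequality `Cov(1_{A∩B}, 1_{A∩C}) ≥ P(A)·P(B∩C∖A)` ("SQKD"); its easy faces are theorems

Support file (seat `prim-masterthm-p3`; `--supports stmt-CriticalPhenomena-4575`; `run/shared/lean/prim/prim-masterthm/prim-masterthm-p3/HIERARCHY.md`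
§33, memo `FROM-prim-masterthm-p3-g25-SYMMETRIC-CENSUS-AND-SQKD.md`).  Companion of `…TwoPartitionKleitman` (the `k = 2` row of the comb
hierarchy: `twoPartN 𝒰 𝒱 = #(𝒰 ∩ 𝒱) − #(𝒰 ∩ 𝒱ᶜˢ) ≥ 0`, Harris–Kleitman twice).

WHERE IT COMES FROM.  Pin the first slot `A` of Sahi's `E₃` in the slot cube (the pivotal-pair programme, `SahiSlot.PinnedGood`): the pinned bilinear
form splits EXACTLY as `Φ_A = [Sq_A + KD_A] + R_A` (pairs inside `A` plus the Kleitman diagonal, and a signed remainder); LPs put the first block in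
the pivotal-pair cone for every up-set tested, and at the VALUE level it is the polarisation of
`SQKD(A;B,C) := (1 + P(A))·P(ABC) − P(AB)·P(AC) − P(A)·P(BC) = Cov(1_{AB},1_{AC}) − P(A)·P(Aᶜ∩B∩C)`.
For product measures on `{0,1}^n` the degree-2 tensor-Bernstein ("two-copy comb") coefficients of `p ↦ SQKD` are, fibre by fibre, the values of ONE
integer functional of three up-sets `𝒜, ℬ, 𝒞` of the split cube and the antipode `S ↦ Sᶜ` (`𝒳ᶜˢ` = the complements of the members of `𝒳`):

  `threeSetN 𝒜 ℬ 𝒞 = #(𝒜∩ℬ∩𝒞) + #(𝒜∩ℬ∩𝒞 ∩ 𝒜ᶜˢ) − #(𝒜∩ℬ ∩ 𝒜ᶜˢ∩𝒞ᶜˢ) − #(𝒜 ∩ ℬᶜˢ∩𝒞ᶜˢ)`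

(uniform measure, antipodal coupling `ω' = ωᶜ`: `P(ABC) + P(ω∈ABC, ω'∈A) − P(ω∈AB, ω'∈AC) − P(ω∈A, ω'∈BC)`; the same expression with an
INDEPENDENT copy `ω'` is `SQKD`).  `threeSetN ≥ 0` for all up-sets (`ThreeSetAntipodal`, CONJECTURE) ⟹ `SQKD ≥ 0` for every product measure on every
finite cube (conditioning on one coordinate turns the statement into a positive mixture of itself and of its two-cube-indexed version; the base of
the induction is exactly `threeSetN ≥ 0`; memo §3).  EVIDENCE (not in the kernel): `threeSetN ≥ 0` for ALL up-set triples of `2^[k]`, `k ≤ 5`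
(`k = 5`: all 7 581 up-sets `𝒜` × all `5.7·10⁷` pairs `(ℬ,𝒞)`, kit j237065), random `𝒜` with exact minimisation over `(ℬ,𝒞)` by alternating
min-weight-up-set (max-flow) steps for `k = 6..12` (≈ 1.5·10⁴ up-sets `𝒜`, no negative value), all symmetric weight-threshold triples `k ≤ 30`, all
'two-junta × weight' triples `k ≤ 12`; `SQKD ≥ 0` for all triples on `{0,1}^m`, `m ≤ 5` (`p ∈ {.3,.5,.7}`, plus `m ≤ 4` at `p ∈ {1/3,.2,.8}`); and
the pinned slot block `Sq_A + KD_A` in the pivotal-pair cone for all 980 up-sets of `[3]^3` and all `S_d`-invariant up-sets of `[3]^4`, `[3]^5`.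
Equality: `𝒜 = ℬ ∪ 𝒞` with `ℬ, 𝒞` on disjoint supports.
THIS FILE (all proved, standard axioms): the functional, its three DEGENERATE faces are the two-set functional (`threeSetN_univ_left/mid/right`:
each is `twoPartN`, hence `≥ 0`), the DIAGONAL face `ℬ = 𝒞` and the NESTED face `𝒜 ⊆ 𝒞` are nonnegative (`threeSetN_nonneg_of_eq`,
`threeSetN_nonneg_of_subset`); the general statement is recorded as the `@[conjecture]` `ThreeSetAntipodal` — an obligation, never a fact.
The strengthening with a symmetric third term (`#(𝒞 ∩ 𝒜ᶜˢ)` demanded only of `𝒞 ∖ 𝒜`, mirror for `𝒜 ∖ 𝒞`) is FALSE (`𝒜 = {x₁}, 𝒞 = {x₂}`), and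
`threeSetN` is not a type-level combination of two-set sandwiches (LP, memo §3) — a proof needs the up-set structure globally, as for Harris.
HONEST LABEL: a conjecture with its easy cases; nothing here bears on the crux or on Sahi's `C₃`. [this work]
-/

namespace Summit.CriticalPhenomena.PercolationContinuityZ3.Theorems.TwoPartition

open Finset
open scoped FinsetFamily

variable {α : Type*} [DecidableEq α] [Fintype α]

/-- The three-set antipodal functional `#(𝒜ℬ𝒞) + #(𝒜ℬ𝒞 ∩ 𝒜ᶜˢ) − #(𝒜ℬ ∩ 𝒜ᶜˢ𝒞ᶜˢ) − #(𝒜 ∩ ℬᶜˢ𝒞ᶜˢ)` (two-copy comb form of `SQKD`). [this work] -/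
def threeSetN (𝒜 ℬ 𝒞 : Finset (Finset α)) : ℤ :=
  (#(𝒜 ∩ ℬ ∩ 𝒞) : ℤ) + #(𝒜 ∩ ℬ ∩ 𝒞 ∩ 𝒜ᶜˢ) - #(𝒜 ∩ ℬ ∩ 𝒜ᶜˢ ∩ 𝒞ᶜˢ) - #(𝒜 ∩ ℬᶜˢ ∩ 𝒞ᶜˢ)

/-- **CONJECTURE `ThreeSetAntipodal`** (this work; open): `threeSetN 𝒜 ℬ 𝒞 ≥ 0` for all up-sets `𝒜, ℬ, 𝒞` of every finite cube.  Equivalent to the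
degree-2 comb positivity of `SQKD`; implies `Cov(1_{A∩B},1_{A∩C}) ≥ P(A)·P(B∩C∖A)` for increasing events under every product measure.  Verified
exhaustively on `2^[k]`, `k ≤ 5`; an obligation / hypothesis — never a fact. [this work] [status: open] -/
@[conjecture] def ThreeSetAntipodal : Prop :=
  ∀ (n : ℕ) (𝒜 ℬ 𝒞 : Finset (Finset (Fin n))), IsUpperSet (𝒜 : Set (Finset (Fin n))) → IsUpperSet (ℬ : Set (Finset (Fin n))) →
    IsUpperSet (𝒞 : Set (Finset (Fin n))) → 0 ≤ threeSetN 𝒜 ℬ 𝒞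

/-! ### The three degenerate faces are the two-set functional -/

/-- `𝒜 = ⊤`: `threeSetN ⊤ ℬ 𝒞 = twoPartN ℬ 𝒞`. [this work] -/
theorem threeSetN_univ_left (ℬ 𝒞 : Finset (Finset α)) : threeSetN univ ℬ 𝒞 = twoPartN ℬ 𝒞 := by
  unfold threeSetN twoPartN
  have h1 : (univ : Finset (Finset α)) ∩ ℬ ∩ 𝒞 ∩ univᶜˢ = ℬ ∩ 𝒞 := by rw [compls_univ, univ_inter, inter_univ]
  have h2 : (univ : Finset (Finset α)) ∩ ℬ ∩ univᶜˢ ∩ 𝒞ᶜˢ = ℬ ∩ 𝒞ᶜˢ := by rw [compls_univ, univ_inter, inter_univ]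
  have h3 : (univ : Finset (Finset α)) ∩ ℬᶜˢ ∩ 𝒞ᶜˢ = (ℬ ∩ 𝒞)ᶜˢ := by rw [univ_inter, compls_inter]
  rw [h1, h2, h3, card_compls, univ_inter]
  omega

/-- `𝒞 = ⊤`: `threeSetN 𝒜 ℬ ⊤ = twoPartN 𝒜 ℬ`. [this work] -/
theorem threeSetN_univ_right (𝒜 ℬ : Finset (Finset α)) : threeSetN 𝒜 ℬ univ = twoPartN 𝒜 ℬ := by
  unfold threeSetN twoPartN
  rw [compls_univ, inter_univ, inter_univ, inter_univ]
  omega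

/-- The antipode is a bijection of `𝒜 ∩ 𝒜ᶜˢ`: `#(𝒜 ∩ 𝒜ᶜˢ ∩ 𝒞) = #(𝒜 ∩ 𝒜ᶜˢ ∩ 𝒞ᶜˢ)`. [this work] -/
theorem card_inter_compls_inter_eq (𝒜 𝒞 : Finset (Finset α)) : #(𝒜 ∩ 𝒜ᶜˢ ∩ 𝒞) = #(𝒜 ∩ 𝒜ᶜˢ ∩ 𝒞ᶜˢ) := by
  rw [← card_compls (𝒜 ∩ 𝒜ᶜˢ ∩ 𝒞), compls_inter, compls_inter, compls_compls, inter_comm 𝒜ᶜˢ 𝒜]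

/-- `ℬ = ⊤`: `threeSetN 𝒜 ⊤ 𝒞 = twoPartN 𝒜 𝒞` (the two `𝒜 ∩ 𝒜ᶜˢ`-terms cancel by the antipode). [this work] -/
theorem threeSetN_univ_mid (𝒜 𝒞 : Finset (Finset α)) : threeSetN 𝒜 univ 𝒞 = twoPartN 𝒜 𝒞 := by
  unfold threeSetN twoPartN
  simp only [compls_univ, inter_univ]
  have h : #(𝒜 ∩ 𝒞 ∩ 𝒜ᶜˢ) = #(𝒜 ∩ 𝒜ᶜˢ ∩ 𝒞ᶜˢ) := by rw [inter_right_comm, card_inter_compls_inter_eq]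
  rw [h]
  omega

/-- Hence the three degenerate faces are nonnegative (Harris–Kleitman twice, via `twoPartN_nonneg`). [this work] -/
theorem threeSetN_nonneg_univ_left {ℬ 𝒞 : Finset (Finset α)} (hℬ : IsUpperSet (ℬ : Set (Finset α)))
    (h𝒞 : IsUpperSet (𝒞 : Set (Finset α))) : 0 ≤ threeSetN univ ℬ 𝒞 := by
  rw [threeSetN_univ_left]; exact twoPartN_nonneg hℬ h𝒞

/-- `𝒞 = ⊤` face. [this work] -/
theorem threeSetN_nonneg_univ_right {𝒜 ℬ : Finset (Finset α)} (h𝒜 : IsUpperSet (𝒜 : Set (Finset α)))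
    (hℬ : IsUpperSet (ℬ : Set (Finset α))) : 0 ≤ threeSetN 𝒜 ℬ univ := by
  rw [threeSetN_univ_right]; exact twoPartN_nonneg h𝒜 hℬ

/-- `ℬ = ⊤` face. [this work] -/
theorem threeSetN_nonneg_univ_mid {𝒜 𝒞 : Finset (Finset α)} (h𝒜 : IsUpperSet (𝒜 : Set (Finset α)))
    (h𝒞 : IsUpperSet (𝒞 : Set (Finset α))) : 0 ≤ threeSetN 𝒜 univ 𝒞 := by
  rw [threeSetN_univ_mid]; exact twoPartN_nonneg h𝒜 h𝒞

/-! ### The diagonal face `ℬ = 𝒞` and the nested face `𝒜 ⊆ 𝒞` -/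

/-- **Diagonal face**: `threeSetN 𝒜 ℬ ℬ = twoPartN 𝒜 ℬ + #(𝒜 ∩ ℬ ∩ 𝒜ᶜˢ ∖ ℬᶜˢ… ) ≥ 0` — the two-set sandwich plus a cardinality. [this work] -/
theorem threeSetN_nonneg_of_eq {𝒜 ℬ : Finset (Finset α)} (h𝒜 : IsUpperSet (𝒜 : Set (Finset α)))
    (hℬ : IsUpperSet (ℬ : Set (Finset α))) : 0 ≤ threeSetN 𝒜 ℬ ℬ := by
  unfold threeSetN
  rw [inter_assoc 𝒜 ℬ ℬ, inter_self, inter_assoc 𝒜 ℬᶜˢ ℬᶜˢ, inter_self]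
  have h1 : 0 ≤ twoPartN 𝒜 ℬ := twoPartN_nonneg h𝒜 hℬ
  unfold twoPartN at h1
  have h2 : #(𝒜 ∩ ℬ ∩ 𝒜ᶜˢ ∩ ℬᶜˢ) ≤ #(𝒜 ∩ ℬ ∩ 𝒜ᶜˢ) := card_le_card inter_subset_left
  omega

/-- **Nested face** `𝒜 ⊆ 𝒞`: then `threeSetN 𝒜 ℬ 𝒞 = #(𝒜∩ℬ) − #(𝒜 ∩ (ℬ∩𝒞)ᶜˢ) ≥ twoPartN 𝒜 ℬ ≥ 0`. [this work] -/
theorem threeSetN_nonneg_of_subset {𝒜 ℬ 𝒞 : Finset (Finset α)} (h𝒜 : IsUpperSet (𝒜 : Set (Finset α)))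
    (hℬ : IsUpperSet (ℬ : Set (Finset α))) (h : 𝒜 ⊆ 𝒞) : 0 ≤ threeSetN 𝒜 ℬ 𝒞 := by
  unfold threeSetN
  have hc : 𝒜ᶜˢ ⊆ 𝒞ᶜˢ := compls_subset_compls.2 h
  have e1 : 𝒜 ∩ ℬ ∩ 𝒞 = 𝒜 ∩ ℬ := by
    rw [inter_right_comm, inter_eq_left.2 h]
  have e2 : 𝒜 ∩ ℬ ∩ 𝒜ᶜˢ ∩ 𝒞ᶜˢ = 𝒜 ∩ ℬ ∩ 𝒜ᶜˢ := by
    rw [inter_assoc (𝒜 ∩ ℬ) 𝒜ᶜˢ 𝒞ᶜˢ, inter_eq_left.2 hc]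
  rw [e1, e2]
  have h1 : 0 ≤ twoPartN 𝒜 ℬ := twoPartN_nonneg h𝒜 hℬ
  unfold twoPartN at h1
  have h2 : #(𝒜 ∩ ℬᶜˢ ∩ 𝒞ᶜˢ) ≤ #(𝒜 ∩ ℬᶜˢ) := card_le_card inter_subset_left
  omega

/-! ### Two more faces: complement-free `𝒜`, and `ℬ ∩ 𝒞 ⊆ 𝒜` -/

/-- **Complement-free face**: if `𝒜` contains no two complementary members (`𝒜 ∩ 𝒜ᶜˢ = ∅`; e.g. any up-set inside a dictatorship, or
majority on an odd ground set) then `threeSetN 𝒜 ℬ 𝒞 = twoPartN 𝒜 (ℬ ∩ 𝒞) ≥ 0`. [this work] -/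
theorem threeSetN_nonneg_of_inter_compls_eq_empty {𝒜 ℬ 𝒞 : Finset (Finset α)} (h𝒜 : IsUpperSet (𝒜 : Set (Finset α)))
    (hℬ : IsUpperSet (ℬ : Set (Finset α))) (h𝒞 : IsUpperSet (𝒞 : Set (Finset α))) (hF : 𝒜 ∩ 𝒜ᶜˢ = ∅) :
    0 ≤ threeSetN 𝒜 ℬ 𝒞 := by
  unfold threeSetN
  have e1 : 𝒜 ∩ ℬ ∩ 𝒞 ∩ 𝒜ᶜˢ = ∅ := by
    rw [inter_right_comm (𝒜 ∩ ℬ), inter_right_comm 𝒜, hF, empty_inter, empty_inter]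
  have e2 : 𝒜 ∩ ℬ ∩ 𝒜ᶜˢ ∩ 𝒞ᶜˢ = ∅ := by
    rw [inter_right_comm 𝒜, hF, empty_inter, empty_inter]
  have e3 : 𝒜 ∩ ℬᶜˢ ∩ 𝒞ᶜˢ = 𝒜 ∩ (ℬ ∩ 𝒞)ᶜˢ := by rw [compls_inter, inter_assoc]
  rw [e1, e2, e3, card_empty, inter_assoc 𝒜 ℬ 𝒞]
  have hW : IsUpperSet ((ℬ ∩ 𝒞 : Finset (Finset α)) : Set (Finset α)) := by
    rw [coe_inter]; exact hℬ.inter h𝒞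
  have h1 : 0 ≤ twoPartN 𝒜 (ℬ ∩ 𝒞) := twoPartN_nonneg h𝒜 hW
  unfold twoPartN at h1
  omega

/-- **Absorbing face** `ℬ ∩ 𝒞 ⊆ 𝒜`: then `threeSetN ≥ #(ℬ∩𝒞) − #(𝒜∩ℬ ∩ (𝒜∩𝒞)ᶜˢ) ≥ 0`, by Harris–Kleitman twice
(`2^n·#(𝒜ℬ ∩ (𝒜𝒞)ᶜˢ) ≤ #(𝒜ℬ)·#(𝒜𝒞) ≤ 2^n·#(𝒜ℬ𝒞)`). [this work] -/
theorem threeSetN_nonneg_of_inter_subset {𝒜 ℬ 𝒞 : Finset (Finset α)} (h𝒜 : IsUpperSet (𝒜 : Set (Finset α)))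
    (hℬ : IsUpperSet (ℬ : Set (Finset α))) (h𝒞 : IsUpperSet (𝒞 : Set (Finset α))) (h : ℬ ∩ 𝒞 ⊆ 𝒜) :
    0 ≤ threeSetN 𝒜 ℬ 𝒞 := by
  unfold threeSetN
  have hAB : IsUpperSet ((𝒜 ∩ ℬ : Finset (Finset α)) : Set (Finset α)) := by rw [coe_inter]; exact h𝒜.inter hℬ
  have hAC : IsUpperSet ((𝒜 ∩ 𝒞 : Finset (Finset α)) : Set (Finset α)) := by rw [coe_inter]; exact h𝒜.inter h𝒞
  -- Harris–Kleitman for the two up-sets `𝒜ℬ`, `𝒜𝒞`, and for the up-set `𝒜ℬ` against the down-set `(𝒜𝒞)ᶜˢ`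
  have k1 : #(𝒜 ∩ ℬ) * #(𝒜 ∩ 𝒞) ≤ 2 ^ Fintype.card α * #(𝒜 ∩ ℬ ∩ (𝒜 ∩ 𝒞)) := hAB.le_card_inter_finset hAC
  have k2 : 2 ^ Fintype.card α * #(𝒜 ∩ ℬ ∩ (𝒜 ∩ 𝒞)ᶜˢ) ≤ #(𝒜 ∩ ℬ) * #(𝒜 ∩ 𝒞)ᶜˢ :=
    hAB.card_inter_le_finset (isLowerSet_compls hAC)
  rw [card_compls] at k2
  have e0 : 𝒜 ∩ ℬ ∩ (𝒜 ∩ 𝒞) = 𝒜 ∩ ℬ ∩ 𝒞 := by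
    ext x; simp only [mem_inter]; tauto
  rw [e0] at k1
  have k3 : #(𝒜 ∩ ℬ ∩ (𝒜 ∩ 𝒞)ᶜˢ) ≤ #(𝒜 ∩ ℬ ∩ 𝒞) :=
    Nat.le_of_mul_le_mul_left (k2.trans k1) (Nat.two_pow_pos _)
  -- the two subtracted terms: `𝒜ℬ ∩ 𝒜ᶜˢ𝒞ᶜˢ = 𝒜ℬ ∩ (𝒜𝒞)ᶜˢ`, and `#(𝒜 ∩ (ℬ𝒞)ᶜˢ) = #(ℬ𝒞 ∩ 𝒜ᶜˢ)` (antipode) cancels the second positive term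
  have e1 : 𝒜 ∩ ℬ ∩ 𝒜ᶜˢ ∩ 𝒞ᶜˢ = 𝒜 ∩ ℬ ∩ (𝒜 ∩ 𝒞)ᶜˢ := by rw [compls_inter, inter_assoc (𝒜 ∩ ℬ)]
  have e2 : #(𝒜 ∩ ℬᶜˢ ∩ 𝒞ᶜˢ) = #(ℬ ∩ 𝒞 ∩ 𝒜ᶜˢ) := by
    rw [inter_assoc, ← compls_inter, ← card_compls (𝒜 ∩ (ℬ ∩ 𝒞)ᶜˢ), compls_inter, compls_compls, inter_comm]
  have e3 : 𝒜 ∩ ℬ ∩ 𝒞 = ℬ ∩ 𝒞 := by rw [inter_assoc]; exact inter_eq_right.2 h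
  rw [e1, e2]
  rw [e3] at k3 ⊢
  omega

end Summit.CriticalPhenomena.PercolationContinuityZ3.Theorems.TwoPartition
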